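import Summits.CriticalPhenomena.SAWScalingLimit.Theorems.SAWLeftRightFKGLeftRightFKGDefs
import Summits.CriticalPhenomena.SAWScalingLimit.Theorems.LeftRightFKG.Negative.OrderCharacterisation
import Summits.CriticalPhenomena.SAWScalingLimit.Theorems.LeftRightFKG.Negative.RectMesh
import HarnessLib

/-!
# Crux `LeftRightFKG` (stmt-CriticalPhenomena-11232), line `corner-localisation` (v9):
the lattice interface of the 2-row ladder (`stub_ladderChords_of_structure`, tool T4b)

From the combinatorial structure theorem of the 2-row ladder `{0..L} × {0, 1}` (tool T4a,
`stub_ladderStructure`, taken VERBATIM as the hypothesis: (i) chords `(0,0) ⇝ (L,0)` stay in the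
ladder, (ii) every facewise crossing count `wcross i 0 γ` (`i < L`) is `0` or `1`, (iii) the length
formula `|γ| = L + #{i ≤ L : [1 ≤ wcross i 0 γ] ≠ [1 ≤ wcross (i-1) 0 γ]}`, (iv) chords are
determined by their crossing counts, (v) every `0/1` pattern is realised) we derive the interface
consumed by the FKG transfer (tool T3): the crossing-indicator map
`f γ = ([1 ≤ wcross i 0 γ])_{i < L} : chords → (Fin L → Bool)` is

* a BIJECTION ((iv) + (ii) give injectivity, (v) surjectivity);
* ORDER-COMPATIBLE: `f γ₁ ≤ f γ₂` pointwise implies `γ₁ ≼ γ₂` (`CornerLoc.lr`), by the `←`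
  direction of the landed order characterisation `Negative.wind_nonneg_iff_wcross` on the bounding
  box `[0, L] × [0, 1]` (from (i)), whose faces are exactly `(m, 0)`, `0 ≤ m < L`, where the counts
  lie in `{0, 1}` by (ii);
* LENGTH-SUBMODULAR: if `f γ₃ = f γ₁ ⊓ f γ₂` and `f γ₄ = f γ₁ ⊔ f γ₂` then
  `|γ₃| + |γ₄| ≤ |γ₁| + |γ₂|`, by the length formula (iii): at the faces `0 ≤ i < L` the row
  indicators of `γ₃`, `γ₄` are the `and` / `or` of those of `γ₁`, `γ₂`; at the phantom faces `-1`
  and `L` every chord has crossing count `0` (no dart of a walk with columns in `[0, L]` crosses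
  `x = -½` or `x = L + ½`), so the same description holds trivially; then termwise the bitwise
  inequality `[p∧p' ≠ q∧q'] + [p∨p' ≠ q∨q'] ≤ [p ≠ q] + [p' ≠ q']`.

Everything is elementary; the only landed input is `Negative.wind_nonneg_iff_wcross`. [folklore]
-/

open Literature.Probability.LatticeModels Literature.Probability.RandomPlanarGeometry
open Summit.CriticalPhenomena.SAWScalingLimit.Theorems.LeftRightFKG.Negative (bx pathCross wcross)
open Summit.CriticalPhenomena.SAWScalingLimit.Theorems.LeftRightFKG.CornerLoc (lr IsUp μx dom IsInst)

namespace Summit.CriticalPhenomena.SAWScalingLimit.Theorems.LeftRightFKG.Families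

section LadderChords

variable {G : SimpleGraph (Site 2)}

/-- PHANTOM FACES: a walk all of whose vertices have column in `[0, L]` does not cross the lines
`x = L + ½` and `x = -½`, so its crossing counts at the faces `(L, 0)` and `(-1, 0)` vanish (every
dart has both endpoints in the support). [folklore] -/
private theorem ladderChords_wcross_phantom {u v : Site 2} (p : G.Walk u v) {L : ℕ}
    (h : ∀ x ∈ p.support, (0 ≤ x 0 ∧ x 0 ≤ (L : ℤ)) ∧ (0 ≤ x 1 ∧ x 1 ≤ 1)) :
    wcross (L : ℤ) 0 p = 0 ∧ wcross (-1) 0 p = 0 := by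
  rw [Negative.wcross_eq_darts, Negative.wcross_eq_darts]
  refine ⟨List.sum_eq_zero fun a ha => ?_, List.sum_eq_zero fun a ha => ?_⟩
  · obtain ⟨d, hd, rfl⟩ := List.mem_map.1 ha
    have h1 := h _ (p.dart_fst_mem_support_of_mem_darts hd)
    have h2 := h _ (p.dart_snd_mem_support_of_mem_darts hd)
    unfold Negative.edgeCross
    split_ifs <;> omega
  · obtain ⟨d, hd, rfl⟩ := List.mem_map.1 ha
    have h1 := h _ (p.dart_fst_mem_support_of_mem_darts hd)
    have h2 := h _ (p.dart_snd_mem_support_of_mem_darts hd)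
    unfold Negative.edgeCross
    split_ifs <;> omega

/-- Two counts in `{0, 1}` with the same indicator `[1 ≤ ·]` are equal. [folklore] -/
private theorem ladderChords_eq_of_decide {c₁ c₂ : ℤ} (h₁ : c₁ = 0 ∨ c₁ = 1) (h₂ : c₂ = 0 ∨ c₂ = 1)
    (h : decide (1 ≤ c₁) = decide (1 ≤ c₂)) : c₁ = c₂ := by
  rcases h₁ with rfl | rfl <;> rcases h₂ with rfl | rfl <;> revert h <;> decide

/-- Two counts in `{0, 1}` with ordered indicators `[1 ≤ ·]` are ordered. [folklore] -/
private theorem ladderChords_le_of_decide {c₁ c₂ : ℤ} (h₁ : c₁ = 0 ∨ c₁ = 1) (h₂ : c₂ = 0 ∨ c₂ = 1)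
    (h : decide (1 ≤ c₁) ≤ decide (1 ≤ c₂)) : c₁ ≤ c₂ := by
  rcases h₁ with rfl | rfl <;> rcases h₂ with rfl | rfl <;> revert h <;> decide

/-- The BITWISE INEQUALITY behind submodularity of the number of row changes:
`[p∧p' ≠ q∧q'] + [p∨p' ≠ q∨q'] ≤ [p ≠ q] + [p' ≠ q']`. [folklore] -/
private theorem ladderChords_bool_ineq (p p' q q' : Bool) :
    ((if (p && p') ≠ (q && q') then 1 else 0) + (if (p || p') ≠ (q || q') then 1 else 0) : ℕ) ≤
      (if p ≠ q then 1 else 0) + (if p' ≠ q' then 1 else 0) := by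
  revert p p' q q'
  decide

/-- SUBMODULARITY OF THE NUMBER OF CHANGES: for Boolean sequences `b₁ b₂ b₃ b₄` on the integer
faces `-1 ≤ j ≤ L` with `b₃ = b₁ ∧ b₂` and `b₄ = b₁ ∨ b₂` there, the numbers of indices
`i ≤ L` with `b i ≠ b (i - 1)` satisfy `#₃ + #₄ ≤ #₁ + #₂` (termwise `ladderChords_bool_ineq`).
[folklore] -/
private theorem ladderChords_card_le (L : ℕ) (b₁ b₂ b₃ b₄ : ℤ → Bool)
    (h3 : ∀ j : ℤ, -1 ≤ j → j ≤ L → b₃ j = (b₁ j && b₂ j))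
    (h4 : ∀ j : ℤ, -1 ≤ j → j ≤ L → b₄ j = (b₁ j || b₂ j)) :
    ((Finset.range (L + 1)).filter (fun i : ℕ => b₃ i ≠ b₃ ((i : ℤ) - 1))).card +
      ((Finset.range (L + 1)).filter (fun i : ℕ => b₄ i ≠ b₄ ((i : ℤ) - 1))).card ≤
    ((Finset.range (L + 1)).filter (fun i : ℕ => b₁ i ≠ b₁ ((i : ℤ) - 1))).card +
      ((Finset.range (L + 1)).filter (fun i : ℕ => b₂ i ≠ b₂ ((i : ℤ) - 1))).card := by
  simp only [Finset.card_filter]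
  rw [← Finset.sum_add_distrib, ← Finset.sum_add_distrib]
  refine Finset.sum_le_sum fun i hi => ?_
  have hiL : (i : ℤ) ≤ L := by
    have := Finset.mem_range.1 hi
    omega
  rw [h3 i (by omega) hiL, h3 ((i : ℤ) - 1) (by omega) (by omega), h4 i (by omega) hiL,
    h4 ((i : ℤ) - 1) (by omega) (by omega)]
  exact ladderChords_bool_ineq _ _ _ _

end LadderChords

/-- STUB T4b `stub_ladderChords_of_structure`: from the ladder combinatorics (T4a, verbatim as
hypothesis) to the lattice-theoretic interface consumed by the FKG transfer: the crossing-indicator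
map `f γ = (1 ≤ wcross i 0 γ)_{i<L}` is a BIJECTION onto `Fin L → Bool` ((iv)+(v)), pointwise `≤`
implies `≼` (`Negative.wind_nonneg_iff_wcross` on the bounding box `[0,L]×[0,1]`, faces `(i,0)`,
counts in `{0,1}` by (ii)), and length is submodular along `f` (formula (iii), vanishing of the
counts at the phantom faces `-1`, `L`, and the bitwise inequality
`[p∧p' ≠ q∧q'] + [p∨p' ≠ q∨q'] ≤ [p ≠ q] + [p' ≠ q']`). The map `f` is universally quantified with
its pointwise definition as a hypothesis (a `let`-free form of the skeleton's `let f := …`). [folklore] -/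
theorem stub_ladderChords_of_structure :
    (∀ (L : ℕ) (Ω : Set ℂ),
      (∀ u v : Site 2, (discreteDomainGraph Ω 1).Adj u v ↔
        (zdGraph 2).Adj u v ∧ u ∈ Negative.Rect.box (-1) (L + 1) (-1) 2 ∧ v ∈ Negative.Rect.box (-1) (L + 1) (-1) 2) →
      (∀ γ : SAW.DomainSAW Ω 1 (bx 0 0) (bx L 0),
        (∀ v ∈ γ.walk.support, (0 ≤ v 0 ∧ v 0 ≤ L) ∧ (0 ≤ v 1 ∧ v 1 ≤ 1)) ∧
        (∀ i : ℕ, i < L → wcross i 0 γ.walk = 0 ∨ wcross i 0 γ.walk = 1) ∧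
        γ.length = L + ((Finset.range (L + 1)).filter (fun i : ℕ =>
          decide (1 ≤ wcross i 0 γ.walk) ≠ decide (1 ≤ wcross ((i : ℤ) - 1) 0 γ.walk))).card) ∧
      (∀ γ₁ γ₂ : SAW.DomainSAW Ω 1 (bx 0 0) (bx L 0),
        (∀ i : ℕ, i < L → wcross i 0 γ₁.walk = wcross i 0 γ₂.walk) → γ₁ = γ₂) ∧
      (∀ v : Fin L → Bool, ∃ γ : SAW.DomainSAW Ω 1 (bx 0 0) (bx L 0),
        ∀ i : Fin L, decide (1 ≤ wcross (i : ℤ) 0 γ.walk) = v i)) →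
    ∀ (L : ℕ) (Ω : Set ℂ),
    (∀ u v : Site 2, (discreteDomainGraph Ω 1).Adj u v ↔
      (zdGraph 2).Adj u v ∧ u ∈ Negative.Rect.box (-1) (L + 1) (-1) 2 ∧ v ∈ Negative.Rect.box (-1) (L + 1) (-1) 2) →
    ∀ f : SAW.DomainSAW Ω 1 (bx 0 0) (bx L 0) → (Fin L → Bool),
    (∀ (γ : SAW.DomainSAW Ω 1 (bx 0 0) (bx L 0)) (i : Fin L), f γ i = decide (1 ≤ wcross (i : ℤ) 0 γ.walk)) →
    Function.Bijective f ∧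
    (∀ γ₁ γ₂, f γ₁ ≤ f γ₂ → lr γ₁ γ₂) ∧
    (∀ γ₁ γ₂ γ₃ γ₄, f γ₃ = f γ₁ ⊓ f γ₂ → f γ₄ = f γ₁ ⊔ f γ₂ → γ₃.length + γ₄.length ≤ γ₁.length + γ₂.length) := by
  intro H L Ω hadj
  obtain ⟨hS, hdet, hreal⟩ := H L Ω hadj
  intro f hf
  obtain rfl : f = fun (γ : SAW.DomainSAW Ω 1 (bx 0 0) (bx L 0)) (i : Fin L) =>
      decide (1 ≤ wcross (i : ℤ) 0 γ.walk) := funext fun γ => funext fun i => hf γ i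
  have hG : ∀ x y, (discreteDomainGraph Ω 1).Adj x y → (zdGraph 2).Adj x y :=
    fun x y hxy => ((hadj x y).1 hxy).1
  refine ⟨⟨fun γ₁ γ₂ hfe => hdet γ₁ γ₂ fun i hi => ?_, fun v => ?_⟩, fun γ₁ γ₂ hle => ?_,
    fun γ₁ γ₂ γ₃ γ₄ h3 h4 => ?_⟩
  · -- (a) injectivity: equal indicators of counts in `{0, 1}` give equal counts, then (iv)
    have key : decide (1 ≤ wcross (i : ℤ) 0 γ₁.walk) = decide (1 ≤ wcross (i : ℤ) 0 γ₂.walk) :=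
      congrFun hfe ⟨i, hi⟩
    exact ladderChords_eq_of_decide ((hS γ₁).2.1 i hi) ((hS γ₂).2.1 i hi) key
  · -- (a) surjectivity: (v)
    obtain ⟨γ, hγ⟩ := hreal v
    exact ⟨γ, funext fun i => hγ i⟩
  · -- (b) order: facewise dominance on the bounding box `[0, L] × [0, 1]`
    refine (Negative.wind_nonneg_iff_wcross hG γ₁.walk γ₂.walk (hS γ₁).1 (hS γ₂).1).2 ?_
    intro m k hm hmL hk hk1
    obtain rfl : k = 0 := by omega
    lift m to ℕ using hm with i
    have hi : i < L := by exact_mod_cast hmL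
    have key : decide (1 ≤ wcross (i : ℤ) 0 γ₁.walk) ≤ decide (1 ≤ wcross (i : ℤ) 0 γ₂.walk) :=
      hle ⟨i, hi⟩
    exact ladderChords_le_of_decide ((hS γ₁).2.1 i hi) ((hS γ₂).2.1 i hi) key
  · -- (c) submodularity of the length along `f`
    have hrel : ∀ j : ℤ, -1 ≤ j → j ≤ L →
        decide (1 ≤ wcross j 0 γ₃.walk) =
            (decide (1 ≤ wcross j 0 γ₁.walk) && decide (1 ≤ wcross j 0 γ₂.walk)) ∧
          decide (1 ≤ wcross j 0 γ₄.walk) =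
            (decide (1 ≤ wcross j 0 γ₁.walk) || decide (1 ≤ wcross j 0 γ₂.walk)) := by
      intro j hj₁ hj₂
      rcases eq_or_lt_of_le hj₁ with rfl | hj₁'
      · -- phantom face `-1`
        simp only [(ladderChords_wcross_phantom _ (hS _).1).2]
        decide
      rcases eq_or_lt_of_le hj₂ with rfl | hj₂'
      · -- phantom face `L`
        simp only [(ladderChords_wcross_phantom _ (hS _).1).1]
        decide
      lift j to ℕ using (by omega : (0 : ℤ) ≤ j) with i
      have hi : i < L := by exact_mod_cast hj₂'
      have e3 : decide (1 ≤ wcross (i : ℤ) 0 γ₃.walk) =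
          (decide (1 ≤ wcross (i : ℤ) 0 γ₁.walk) && decide (1 ≤ wcross (i : ℤ) 0 γ₂.walk)) :=
        congrFun h3 ⟨i, hi⟩
      have e4 : decide (1 ≤ wcross (i : ℤ) 0 γ₄.walk) =
          (decide (1 ≤ wcross (i : ℤ) 0 γ₁.walk) || decide (1 ≤ wcross (i : ℤ) 0 γ₂.walk)) :=
        congrFun h4 ⟨i, hi⟩
      exact ⟨e3, e4⟩
    have key := ladderChords_card_le L (fun j => decide (1 ≤ wcross j 0 γ₁.walk))
      (fun j => decide (1 ≤ wcross j 0 γ₂.walk)) (fun j => decide (1 ≤ wcross j 0 γ₃.walk))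
      (fun j => decide (1 ≤ wcross j 0 γ₄.walk)) (fun j hj hj' => (hrel j hj hj').1)
      (fun j hj hj' => (hrel j hj hj').2)
    beta_reduce at key
    rw [(hS γ₁).2.2, (hS γ₂).2.2, (hS γ₃).2.2, (hS γ₄).2.2]
    omega

end Summit.CriticalPhenomena.SAWScalingLimit.Theorems.LeftRightFKG.Families
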